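import Summits.CriticalPhenomena.PercolationContinuityZ3.Theorems.Transplant.GrigorchukWitnessConj4Defs
import Summits.CriticalPhenomena.PercolationContinuityZ3.Theorems.Transplant.GrigorchukWitnessNearCriticalLRODefs
import Literature.Probability.Percolation.MeanFieldBetaFromGamma
import Literature.Barriers.CriticalPhenomena.SubexponentialGrowthZdProofs
import HarnessLib

/-!
# The D6 negation schema «supermultiplicative LRO squeeze» on the two Grigorchuk witnesses — NAMED HYPOTHESIS DEFS + PROVED IMPLICATIONS
# (the door as an implication; the lever proved; the engine a DEF, not proved here)

builds on p205010 (kernel theorem, internal audit signed; external expert review pending) — nothing in this file uses p205010.  Lane `prim-bschramm`,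
seat `prim-bschramm-stmt` gen 41 (port pen) under director-frontier g15's ruling #9030 (c) («the D6 / D8 negation schemas ONLY as 'named hypothesis defs
+ proved implication' files, one each, AFTER N1, no new named facts beyond print»), lead g28's queue of record #9147 / #9174 (b), and the design desk's
TYPING SPEC (p3 g41 #9171).  SOURCE TEXT: w-idea-2 g3 CARD-3 «supermultiplicative-lro-squeeze» (2a27a539) + `Sketch-CARD-3.lean` (7a3bcb2d) — the decl
shapes below are the Sketch's, verbatim.  Helper file (`--supports stmt-CriticalPhenomena-4575 --as helper`).  NO `@[conjecture]`; NO new named FACT;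
NOTHING here asserts `θ(p_c) = 0` on either witness or any growth exponent — `GluedIfJump`, `FiniteGammaSeq`, `GrowthWindow`, `NegationEngine` are
HYPOTHESIS DEFS, the doors `DoorD6Std b` / `DoorD6Gz b` are IMPLICATION-SHAPED DEFS (predicates in the gluing exponent `b`), and the only theorems are the lever (§1), two one-line links (§2) and the
pure-logic closures `doorD6Std_of_engine` / `doorD6Gz_of_engine` (§4).  `Grigorchuk.stdCay_conj4`, `Grigorchuk.gzCay_conj4` (p653422), the residue node and
Conjecture 4 stay OPEN.

STANDING OF THIS DOOR (honest, per the record).  D6 is a door WITHOUT MECHANISM for either input (VERDICTS :483 / :487: round 1 found no route to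
`FiniteGammaSeq` anywhere; `GluedIfJump` is irrefutable-in-form and has no printed anchor, p5 #8865).  ON W2 = `Cay(𝔊 × ℤ; a, b, c, d, z)` IT IS SUPERSEDED
AS DOOR OF RECORD: round 2's «geometric-cutoff-slab-susceptibility» (w-idea-2 g6 CARD-6) replaced the thermal cutoff by the kernel-subcritical slab at `p_c`
(D6′, VERDICTS :509) and then discharged the jump side by print, so the W2 door of record is the ONE-INPUT door D12 «`gzCay_conj4` ⟸ SlabSusceptQuasiPoly»
(VERDICTS :516); `DoorD6Gz` below is kept as the W2 twin of the round-1 schema for the record, not as the line's door.  On W1 = `Cay(𝔊; a, b, c, d)` (no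
`ℤ`-factor, no slab family) D6 is unchanged.  The ENGINE PROOF (CARD-3's P2 persistence budget + P3 optimisation; M/L) is NOT in this file — `NegationEngine`
is a `def`, to be PROVED in a later «…LROSqueezeEngine» file on a GO; until then every door theorem here is conditional on it by an explicit hypothesis.

* §1 THE LEVER (proved): `kappa_pow_mul_ballVolume_le_tsum` — `κ_p(L)^j · |B(x, jL)| ≤ χ_p(x)` for every `j` (Hutchcroft 2016 Lemma 4 iterated, WITHOUT the
  Fekete root, over the tree's `kappa_pow_le` / `kappa_mul_ballVolume_le_tsum`, «SubexponentialGrowthZdProofs» :325 / :360) and `lro_squeeze` (with a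
  stretched-exponential growth minorant: `q ≤ κ_p(L)`, `exp(c m^a) ≤ |B(x,m)|` ⇒ `q^j exp(c (jL)^a) ≤ χ_p(x)`).
* §2 THE HYPOTHESIS DEFS: `connIn`, `GluedIfJump` (D6.K1), `FiniteGammaSeq` (D6.K2 = D8.K3) with the link `finiteGammaSeq_of_sq_mul_small` from door D5's
  hypothesis shape (p669280, `C = 2`), `GrowthWindow` (P4) with the link `growthLower_of_growthWindow` to gen-1 g11's `SnowballSqueeze.GrowthLower` (p681346).
* §3 `NegationEngine` (DEF ONLY) and the doors `DoorD6Std b` / `DoorD6Gz b` (implication-shaped DEFS, predicates in the gluing exponent `b`, over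
  the typed targets of p653422).
* §4 `doorD6Std_of_engine`, `doorD6Gz_of_engine` — the doors are pure logic over the engine (by_contra on `θ > 0`, `θ ≥ 0` being a real measure).
[cite: Hutchcroft2016, Lemma 4 and §2 (proof of Thm. 2, first display)] [cite: BenjaminiSchramm1996, Conj. 4]
-/

noncomputable section

namespace Summit.CriticalPhenomena.PercolationContinuityZ3.Theorems.Transplant

namespace Grigorchuk

namespace LROSqueeze

open SimpleGraph MeasureTheory Filter Literature.Barriers.CriticalPhenomena Literature.Probability.Percolation
open scoped ENNReal Classical

variable {V : Type}

/-! ### §1 The lever (PROVED): unrolled supermultiplicativity, no Fekete root -/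

/-- **The lever: `κ_p(L)^j · |B(x, jL)| ≤ χ_p(x)`** for every `j`, whenever `χ_p(x) = Σ_y τ_p(x,y) < ∞` — Hutchcroft 2016 Lemma 4 iterated
(`kappa_pow_le`: `κ_p(L)^j ≤ κ_p(jL)`) times the first display of the proof of his Thm. 2 (`kappa_mul_ballVolume_le_tsum`: `κ_p(n)·|B(x,n)| ≤ χ_p(x)`); no
`n`-th root is taken. [cite: Hutchcroft2016, Lemma 4 and §2 (proof of Thm. 2, first display)] -/
theorem kappa_pow_mul_ballVolume_le_tsum [Countable V] [Nonempty V] (G : SimpleGraph V) [G.LocallyFinite]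
    (p : unitInterval) (x : V) (hs : Summable fun y : V => (bondPercolation G p).real (openConn x y)) (L j : ℕ) :
    kappa G p L ^ j * (ballVolume G x (j * L) : ℝ) ≤ ∑' y, (bondPercolation G p).real (openConn x y) :=
  (mul_le_mul_of_nonneg_right (kappa_pow_le G p L j) (Nat.cast_nonneg _)).trans
    (kappa_mul_ballVolume_le_tsum G p x hs (j * L))

/-- **The LRO squeeze with a stretched-exponential growth minorant**: if `q ≤ κ_p(L)` and `exp(c m^a) ≤ |B(x,m)|` for all `m`, then
`q^j · exp(c (jL)^a) ≤ χ_p(x)` for every `j` (optimising in `j` gives `log χ_p(x) ≥ c′ L^{a/(1−a)} log(1/q)^{−a/(1−a)}`; the optimisation belongs to the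
engine, not here).  On `ℤ^d` the same display gives only `χ ≥ c L^d`; the stretched-exponential amplification is specific to intermediate growth.
[cite: Hutchcroft2016, Lemma 4] -/
theorem lro_squeeze [Countable V] [Nonempty V] (G : SimpleGraph V) [G.LocallyFinite] (p : unitInterval) (x : V)
    (hs : Summable fun y : V => (bondPercolation G p).real (openConn x y)) {q c a : ℝ} {L : ℕ}
    (hq0 : 0 ≤ q) (hq : q ≤ kappa G p L) (hgrowth : ∀ m : ℕ, Real.exp (c * (m : ℝ) ^ a) ≤ (ballVolume G x m : ℝ))
    (j : ℕ) : q ^ j * Real.exp (c * ((j * L : ℕ) : ℝ) ^ a) ≤ ∑' y, (bondPercolation G p).real (openConn x y) :=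
  calc q ^ j * Real.exp (c * ((j * L : ℕ) : ℝ) ^ a) ≤ kappa G p L ^ j * (ballVolume G x (j * L) : ℝ) :=
        mul_le_mul (pow_le_pow_left₀ hq0 hq j) (hgrowth (j * L)) (Real.exp_nonneg _) (pow_nonneg (kappa_nonneg G p L) j)
    _ ≤ _ := kappa_pow_mul_ballVolume_le_tsum G p x hs L j

/-! ### §2 The hypothesis defs (Props; NOTHING asserted) and their one-line links to the tree -/

/-- The finite-volume two-point function `τ_p^R(o, x) = P_p(o ↔ x by an open path inside B(o, R))` (real-valued). [folklore] -/
def connIn (G : SimpleGraph V) (p : unitInterval) (o : V) (R : ℕ) (x : V) : ℝ :=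
  (bondPercolation G p).real (openConnIn (graphBall G o R) o x)

/-- **K1 of door D6 — `GluedIfJump(b)`** (HYPOTHESIS DEF; crux WITHOUT mechanism; irrefutable in form since `¬ K1` forces `θ_o(p_c) > 0`; no printed
anchor — refuter p5 #8865): IF `θ_o(p_c) > 0` THEN connections at `p_c` are realised inside a ball of radius polynomial (exponent `b`) in the distance,
with probability `≥ (3/4)·θ_o(p_c)²` (Harris–FKG + uniqueness give `τ_{p_c}(o, x) ≥ θ_o(p_c)²` with NO radius; the content is the radius).  Verbatim
Sketch-CARD-3 :62–:66. [cite: AizenmanKestenNewman1987, (uniqueness; the gluing question)] -/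
def GluedIfJump (G : SimpleGraph V) (o : V) (b : ℝ) : Prop :=
  0 < theta G o (criticalProbIOf G o) →
    ∃ A R₀ : ℝ, ∀ (n : ℕ) (x : V), x ∈ graphBall G o n →
      3 / 4 * theta G o (criticalProbIOf G o) ^ 2 ≤ connIn G (criticalProbIOf G o) o ⌈A * (n : ℝ) ^ b + R₀⌉₊ x

/-- **K2 of door D6 = K3 of door D8 — `FiniteGammaSeq`** (HYPOTHESIS DEF; crux WITHOUT mechanism anywhere — VERDICTS :483): `γ < ∞` along SOME sequence
`p ↑ p_c`, i.e. `∃ C, ∀ δ > 0, ∃ p ∈ (p_c − δ, p_c), E_p|C(o)| ≤ (p_c − p)^{−C}`.  Weaker than door D5's input `liminf_{p↑p_c} (p_c − p)²·E_p|C(o)| = 0`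
(`finiteGammaSeq_of_sq_mul_small`).  Verbatim Sketch-CARD-3 :69–:73. [cite: AizenmanNewman1984, (γ; mean-field bound χ ≥ c/(p_c − p))] -/
def FiniteGammaSeq (G : SimpleGraph V) (o : V) : Prop :=
  ∃ C : ℝ, ∀ δ : ℝ, 0 < δ → ∃ p : unitInterval,
    criticalProb G o - δ < p ∧ (p : ℝ) < criticalProb G o ∧
      expClusterSize G o p ≤ ENNReal.ofReal ((criticalProb G o - p) ^ (-C))

/-- **Door D5's input implies `FiniteGammaSeq` (with `C = 2`)**: the hypothesis shape of «GrigorchukWitnessEntropicDoor» p669280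
(`∀ η > 0, ∀ δ > 0, ∃ p ∈ (p_c − δ, p_c), E_p|C(o)| ≤ η/(p_c − p)²`) at `η = 1`. [folklore] -/
theorem finiteGammaSeq_of_sq_mul_small (G : SimpleGraph V) (o : V)
    (h : ∀ η : ℝ, 0 < η → ∀ δ : ℝ, 0 < δ → ∃ p : unitInterval,
      criticalProb G o - δ < p ∧ (p : ℝ) < criticalProb G o ∧ expClusterSize G o p ≤ ENNReal.ofReal (η / (criticalProb G o - p) ^ 2)) :
    FiniteGammaSeq G o := by
  refine ⟨2, fun δ hδ => ?_⟩
  obtain ⟨p, h1, h2, h3⟩ := h 1 one_pos δ hδ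
  refine ⟨p, h1, h2, h3.trans_eq ?_⟩
  congr 1
  have hpos : 0 < criticalProb G o - p := sub_pos.2 h2
  rw [Real.rpow_neg hpos.le, one_div, show (2 : ℝ) = (2 : ℕ) by norm_num, Real.rpow_natCast]

/-- **P4 — `GrowthWindow(a, α′)`** (HYPOTHESIS DEF): `exp(c m^a) ≤ |B(o, m)| ≤ exp(C (m+1)^{α′})` for all `m`.  For `Cay(𝔊; a, b, c, d)` some `a > 0` and
some `α′ < 1` are kernel-derivable («GrigorchukSuperpolynomialGrowth» `card_wordBall_sq_le`; «GrigorchukSubexponentialGrowth» `gammaW_le_exp` /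
`gammaW_descent`); the PRINT values `a = 1/2` (Grigorchuk 1984), `α′ = log 2 / log(2/η) ≈ 0.7674` with `η³ + η² + η = 2` (Bartholdi 1998; sharp by
Erschler–Zheng 2020, who also give `a ↑ α′`) are
CITATIONS ONLY — no exponent is typed or asserted anywhere (W-CRUX §4 MUST-NOT).  Verbatim Sketch-CARD-3 :78–:81.
[cite: Grigorchuk1984, Thm. (the two growth bounds)] [cite: Bartholdi1998, Prop. (upper exponent)] [cite: ErschlerZheng2020, Thm. 1.1] -/
def GrowthWindow (G : SimpleGraph V) (o : V) (a α' : ℝ) : Prop :=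
  (∃ c : ℝ, 0 < c ∧ ∀ m : ℕ, Real.exp (c * (m : ℝ) ^ a) ≤ (ballVolume G o m : ℝ)) ∧
    (∃ C : ℝ, ∀ m : ℕ, (ballVolume G o m : ℝ) ≤ Real.exp (C * ((m : ℝ) + 1) ^ α'))

/-- **Link to the N1 chain's growth hypothesis**: the lower half of `GrowthWindow` (for ALL `m`) implies gen-1 g11's EVENTUAL form
`SnowballSqueeze.GrowthLower G o a` («GrigorchukWitnessNearCriticalLRODefs» p681346) — trivially, the eventual form being weaker. [folklore] -/
theorem growthLower_of_growthWindow {G : SimpleGraph V} {o : V} {a α' : ℝ} (h : GrowthWindow G o a α') :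
    SnowballSqueeze.GrowthLower G o a := by
  obtain ⟨⟨c, hc, hm⟩, -⟩ := h
  exact ⟨c, hc, Eventually.of_forall hm⟩

/-! ### §3 The engine (DEF ONLY — NOT proved here) and the doors (implication-shaped DEFS over the typed targets) -/

/-- **P3 — the NEGATION ENGINE at `o`** (DEF ONLY; support item M/L, to be PROVED in a later «…LROSqueezeEngine» file from `lro_squeeze` + CARD-3's
persistence budget `P_{p_c}(A) − P_{p_c−ε}(A) ≤ ε·|F|` + Harris–FKG + Burton–Keane at `p_c`): in the window `b·α′·(1−a) < a`, a jump glued at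
polynomial radius forces `log χ(p_c − ε) ≥ c (log 1/ε)^s` with `s = a/((1−a) b α′) > 1`, contradicting `FiniteGammaSeq`.  Verbatim Sketch-CARD-3 :85–:88;
NOT PROVED HERE — it enters §4 only as an explicit hypothesis. [cite: Hutchcroft2016, Lemma 4] -/
def NegationEngine (G : SimpleGraph V) (o : V) : Prop :=
  ∀ a α' b : ℝ, 0 < a → a < 1 → 0 < α' → 0 < b → b * α' * (1 - a) < a →
    GrowthWindow G o a α' → GluedIfJump G o b → 0 < theta G o (criticalProbIOf G o) → ¬ FiniteGammaSeq G o

/-- **DOOR D6 on W1 = `Cay(𝔊; a, b, c, d)`** (IMPLICATION-SHAPED DEF over the typed target `Grigorchuk.stdCay_conj4`, p653422; nothing asserted about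
its hypotheses), AT GLUING EXPONENT `b`: `b > 0` ∧ `GluedIfJump(b)` at every vertex ∧ a growth window with `b·α′·(1−a) < a` ∧ `FiniteGammaSeq` at every
vertex ⇒ `stdCay_conj4`.  Sketch-CARD-3 :90–:96 with the leading `∀ b` pulled out as the def's PARAMETER (the door is a predicate in `b`; a parameterless
cited `def … : Prop` would be relocated by the gate as a Literature 'fact', which a door is not — p686290/p686292).  STANDING: door without mechanism for
K1 / K2 (VERDICTS :483 / :487). [cite: BenjaminiSchramm1996, Conj. 4] -/
def DoorD6Std (b : ℝ) : Prop :=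
  0 < b →
    (∃ a α' : ℝ, 0 < a ∧ a < 1 ∧ 0 < α' ∧ b * α' * (1 - a) < a ∧ ∀ v : ↥grigorchukGroup, GrowthWindow stdCay v a α') →
    (∀ v : ↥grigorchukGroup, GluedIfJump stdCay v b) →
    (∀ v : ↥grigorchukGroup, FiniteGammaSeq stdCay v) → stdCay_conj4

/-- **DOOR D6 on W2 = `Cay(𝔊 × ℤ; a, b, c, d, z)`** AT GLUING EXPONENT `b` (IMPLICATION-SHAPED DEF over `Grigorchuk.gzCay_conj4`, p653422; nothing
asserted).  Sketch-CARD-3 :98–:103 with `b` as the parameter.  STANDING: on W2 this round-1 door is SUPERSEDED as door of record by the one-input door D12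
«`gzCay_conj4` ⟸ SlabSusceptQuasiPoly» (VERDICTS :509 / :516: the geometric cutoff removes `FiniteGammaSeq`, the jump side is discharged by print); kept as
the thermal form / the twin for the record. [cite: BenjaminiSchramm1996, Conj. 4] -/
def DoorD6Gz (b : ℝ) : Prop :=
  0 < b →
    (∃ a α' : ℝ, 0 < a ∧ a < 1 ∧ 0 < α' ∧ b * α' * (1 - a) < a ∧ ∀ x : GZ, GrowthWindow gzCay x a α') →
    (∀ x : GZ, GluedIfJump gzCay x b) →
    (∀ x : GZ, FiniteGammaSeq gzCay x) → gzCay_conj4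

/-! ### §4 The doors are pure logic over the engine (PROVED; `by_contra` on `θ > 0`) -/

/-- **Door D6 on W1 follows from the engine at every vertex** (kernel-checked composition: if `θ_v(p_c) ≠ 0` then `θ_v(p_c) > 0`, and the engine turns the
window + gluing + jump into `¬ FiniteGammaSeq`, contradicting the third hypothesis).  CONDITIONAL on `NegationEngine` (a def, unproved). [cite: BenjaminiSchramm1996, Conj. 4] -/
theorem doorD6Std_of_engine (hE : ∀ v : ↥grigorchukGroup, NegationEngine stdCay v) (b : ℝ) : DoorD6Std b := by
  intro hb hwin hglue hfin v
  obtain ⟨a, α', ha0, ha1, hα, hw, hgrow⟩ := hwin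
  by_contra hθ
  have hpos : 0 < theta stdCay v (criticalProbIOf stdCay v) := lt_of_le_of_ne (by unfold theta; exact measureReal_nonneg) (Ne.symm hθ)
  exact hE v a α' b ha0 ha1 hα hb hw (hgrow v) (hglue v) hpos (hfin v)

/-- **Door D6 on W2 follows from the engine at every vertex** (same composition).  CONDITIONAL on `NegationEngine`. [cite: BenjaminiSchramm1996, Conj. 4] -/
theorem doorD6Gz_of_engine (hE : ∀ x : GZ, NegationEngine gzCay x) (b : ℝ) : DoorD6Gz b := by
  intro hb hwin hglue hfin x
  obtain ⟨a, α', ha0, ha1, hα, hw, hgrow⟩ := hwin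
  by_contra hθ
  have hpos : 0 < theta gzCay x (criticalProbIOf gzCay x) := lt_of_le_of_ne (by unfold theta; exact measureReal_nonneg) (Ne.symm hθ)
  exact hE x a α' b ha0 ha1 hα hb hw (hgrow x) (hglue x) hpos (hfin x)

end LROSqueeze

end Grigorchuk

end Summit.CriticalPhenomena.PercolationContinuityZ3.Theorems.Transplant

end
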